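import Summits.NavierStokesRegularity.NavierStokesRegularity.Theorems.TypeICertificateLadderTargetRungOfDepletion
import HarnessLib

/-!
# Crux `Target` (stmt-NavierStokesRegularity-1217), line `depletion_ladder` (skeleton of record
# `Cruxes/Target/Lines/depletion_ladder.lean`, sha16 `f7213e70113b3d52`): the registered stub S2
# `stub_rung_of_depletion` closed BY NAME

`--supports stmt-NavierStokesRegularity-1217`. Bookkeeping file (seat leafhand-ns-poloidalwindowdoor-2 g0,
cell decomp-ns; same pattern as `UnthreadedDoorAntidynamoStubsByName.lean`, p793446). The registered stub reads

  `stub_rung_of_depletion : ∀ κ : ℝ, 0 < κ → StretchingDepletion κ → ∀ C : ℝ, 0 < C → κ * C < 1 → Rung C`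

where `StretchingDepletion` and `Rung` are the two line-local `def`s of the skeleton (ll. 58, 68), which lives
under `Cruxes/` and is not importable from `Theorems/`. Its content was PROVED in the tree with the two
definitions unfolded: `Theorems.rung_of_stretchingDepletion` (`…TargetRungOfDepletion.lean`, p471856; depleted
enstrophy Grönwall against the Leray/Tao `H¹` blow-up rate). Here the two Props are twinned VERBATIM (the
skeleton's local notation `ℝ³` spelled out as `EuclideanSpace ℝ (Fin 3)`) in the sub-namespace
`Theorems.DepletionLadder.Skeleton`, and the stub is closed under the skeleton's exact header; the two `def`s
unfold definitionally, so the proof term is `rung_of_stretchingDepletion` itself.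

After this file the skeleton's composition `Target_of` is closed modulo S1 `stub_depletionBelowHalf`
(`∃ κ < 1/2, StretchingDepletion κ` for ALL `C²` bounded divergence-free fields — proved in the tree only in the
Tao slice class, `…StrainCube.exists_depletion_lt_half_slice`, which is what RUNG TWO `stub_rungTwo` (p538781)
consumed) and the residual S3 `stub_descentToRungTwo` (= the crux above rung two, the Type-I Liouville content,
OPEN); by `noTypeIBlowup_iff_rungTwo_and_descent` of the skeleton the crux is exactly S3.

HONEST LABEL: bookkeeping; no new mathematics; S1 (general class), S3, the crux `Target` (no Type-I blow-up)
and NS regularity remain OPEN; nothing here bears on the summit.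
-/

noncomputable section

-- the summit and its single sub-problem share the name (CONVENTIONS §1)
set_option linter.dupNamespace false

open Set Filter Topology MeasureTheory
open scoped RealInnerProductSpace
open Literature.Analysis.FluidPDE

namespace Summit.NavierStokesRegularity.NavierStokesRegularity.Theorems.DepletionLadder.Skeleton

/-- **Stretching depletion with constant `κ`** — twin, body VERBATIM, of the line-local `def StretchingDepletion`
of the skeleton `Cruxes/Target/Lines/depletion_ladder.lean` (l. 58): for every `C²` divergence-free field
`u : ℝ³ → ℝ³` bounded by `M`, with square-integrable vorticity `curl u`, square-integrable vorticity gradient and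
integrable stretching density, `|∫ ⟪curl u, Du (curl u)⟫| ≤ κ · M · ‖curl u‖₂ · ‖∇ curl u‖₂`. -/
def StretchingDepletion (κ : ℝ) : Prop :=
  ∀ (u : EuclideanSpace ℝ (Fin 3) → EuclideanSpace ℝ (Fin 3)) (M : ℝ), ContDiff ℝ 2 u →
    VectorCalculus.IsDivFree u → (∀ x, ‖u x‖ ≤ M) →
    Integrable (fun x => ‖curl u x‖ ^ 2) →
    Integrable (fun x => frobeniusNormSq (fderiv ℝ (curl u) x)) →
    Integrable (fun x => ⟪curl u x, fderiv ℝ u x (curl u x)⟫) →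
    |∫ x, ⟪curl u x, fderiv ℝ u x (curl u x)⟫| ≤
      κ * M * Real.sqrt (∫ x, ‖curl u x‖ ^ 2) * Real.sqrt (∫ x, frobeniusNormSq (fderiv ℝ (curl u) x))

/-- **The rung statement `X_C` of the ladder** — twin, body VERBATIM, of the line-local `def Rung` of the skeleton
(l. 68): an eventual dimensionless rate `√(T−t)‖u(t,x)‖ ≤ C√ν` for a classical Leray–Hopf rapidly-decaying-datum
solution of the unforced Navier–Stokes system on `ℝ³ × [0,T)` forces a smooth extension past `T`. -/
def Rung (C : ℝ) : Prop :=
  ∀ (ν T : ℝ), 0 < ν → 0 < T → ∀ (u : ℝ → EuclideanSpace ℝ (Fin 3) → EuclideanSpace ℝ (Fin 3))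
    (p : ℝ → EuclideanSpace ℝ (Fin 3) → ℝ),
    IsClassicalNSSolutionOn (Set.Ico 0 T) ν 0 u p → IsLerayHopfOn T ν 0 (u 0) u →
    HasRapidSpatialDecay (u 0) →
    (∀ᶠ t in 𝓝[<] T, ∀ x, Real.sqrt (T - t) * ‖u t x‖ ≤ C * Real.sqrt ν) →
    HasSmoothExtensionPast ν 0 u T

/-- ★ **The registered stub S2 `stub_rung_of_depletion` of crux stmt-NavierStokesRegularity-1217 BY NAME** (exact
header of the skeleton, l. 103): a depletion constant `κ > 0` closes every rung `X_C` with `κ·C < 1`. Kernel proof: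
`Theorems.rung_of_stretchingDepletion` (p471856), the two twinned `def`s unfolding definitionally. [folklore] -/
theorem stub_rung_of_depletion :
    ∀ κ : ℝ, 0 < κ → StretchingDepletion κ → ∀ C : ℝ, 0 < C → κ * C < 1 → Rung C :=
  fun κ hκ hdep C hC hκC =>
    _root_.Summit.NavierStokesRegularity.NavierStokesRegularity.Theorems.rung_of_stretchingDepletion
      κ hκ hdep C hC hκC

/-- **Monotonicity of the twinned depletion inequality in its constant** (as `stretchingDepletion_mono` of the
skeleton): `StretchingDepletion κ → κ ≤ κ' → StretchingDepletion κ'`. [folklore] -/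
theorem stretchingDepletion_mono {κ κ' : ℝ} (h : StretchingDepletion κ) (hle : κ ≤ κ') :
    StretchingDepletion κ' := by
  intro u M hu hdiv hM h1 h2 h3
  refine (h u M hu hdiv hM h1 h2 h3).trans ?_
  have hM0 : 0 ≤ M := (norm_nonneg _).trans (hM 0)
  have hA : 0 ≤ M * Real.sqrt (∫ x, ‖curl u x‖ ^ 2) *
      Real.sqrt (∫ x, frobeniusNormSq (fderiv ℝ (curl u) x)) := by positivity
  calc κ * M * Real.sqrt (∫ x, ‖curl u x‖ ^ 2) * Real.sqrt (∫ x, frobeniusNormSq (fderiv ℝ (curl u) x))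
      = κ * (M * Real.sqrt (∫ x, ‖curl u x‖ ^ 2) *
          Real.sqrt (∫ x, frobeniusNormSq (fderiv ℝ (curl u) x))) := by ring
    _ ≤ κ' * (M * Real.sqrt (∫ x, ‖curl u x‖ ^ 2) *
          Real.sqrt (∫ x, frobeniusNormSq (fderiv ℝ (curl u) x))) :=
        mul_le_mul_of_nonneg_right hle hA
    _ = κ' * M * Real.sqrt (∫ x, ‖curl u x‖ ^ 2) *
          Real.sqrt (∫ x, frobeniusNormSq (fderiv ℝ (curl u) x)) := by ring

/-- **S1 ∧ S2 ⇒ RUNG TWO over the twins** (as `rungTwo_of_parts` of the skeleton): a depletion constant `κ < 1/2`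
gives `Rung 2` through `stub_rung_of_depletion` (raise `κ` to `max κ (1/4) > 0`, still `< 1/2`). With the tree's
`stub_rungTwo` (p538781) this node is already a theorem; recorded here so that the twinned vocabulary carries the
skeleton's composition up to the residual S3. [folklore] -/
theorem rung_two_of_depletionBelowHalf (h1 : ∃ κ : ℝ, κ < 1 / 2 ∧ StretchingDepletion κ) : Rung 2 := by
  obtain ⟨κ, hκ, hdep⟩ := h1
  have hpos : 0 < max κ (1 / 4) := lt_max_of_lt_right (by norm_num)
  have hlt : max κ (1 / 4) * 2 < 1 := by
    rcases le_total κ (1 / 4) with h | h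
    · rw [max_eq_right h]; norm_num
    · rw [max_eq_left h]; linarith
  exact stub_rung_of_depletion (max κ (1 / 4)) hpos (stretchingDepletion_mono hdep (le_max_left _ _)) 2
    (by norm_num) hlt

end Summit.NavierStokesRegularity.NavierStokesRegularity.Theorems.DepletionLadder.Skeleton

end
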